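import Summits.CriticalPhenomena.SAWScalingLimit.Theorems.SAWRenewalTightnessKestenIdentity
import Summits.CriticalPhenomena.SAWScalingLimit.Theorems.SAWRenewalTightnessConfinementPositivityUnpinnedSlabTubeLemmas
import Literature.Probability.RandomPlanarGeometry.SAWWordBridges
import HarnessLib

/-!
# Crux `ConfinementPositivity` (stmt-CriticalPhenomena-17587), line `Sketch` (sign-universality):
# stub UE `stub_extentSecondMoment_of_expTail` — the exponential extent tail gives the second-moment ceiling

Registered stub UE of the lead skeleton `Cruxes/ConfinementPositivity/Lines/Sketch.lean` (v3):
`ExtentExpTail → ExtentSecondMoment` for Kesten's measure on the irreducible bridge words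
`w : {w : List Step // IsIrrBridge w}` (weight `x_c^{|w|}`, span `xEnd w`, vertical extent
`ext w = max_{i ≤ |w|} |y_i| = (range (|w|+1)).sup (|traj w i 1|)`):

* hypothesis (UAT-exp): `mass{span = s, ext ≥ t s} ≤ C e^{-t/C} · mass{span = s}` for `s, t ≥ 1`
  (real `tsum`s of indicators);
* conclusion (U2): `Σ_{span = s} ext² x_c^{|w|} ≤ C' s² · mass{span = s}` for `s ≥ 1` (in `ℝ≥0∞`).

Proof.  Discrete layer cake: with `m = ⌊ext/s⌋` one has `ext < (m+1)s`, so
`ext² ≤ s²(m+1)² = s²(1 + Σ_{u<m} (2u+3)) = s²(1 + Σ_{u ≥ 0} (2u+3)·1[(u+1)s ≤ ext])`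
(`ExtentOfExpTail.cast_sq_le`).  Summing against the weights and swapping the sums
(`ENNReal.tsum_comm`; everything in `ℝ≥0∞`, no summability needed) bounds the restricted second
moment by `s²(mass{span s} + Σ_u (2u+3)·mass{span s, ext ≥ (u+1)s})`
(`ExtentOfExpTail.tsum_sq_mul_le`, stated for an abstract weight); each tail is `≤ C e^{-(u+1)/C} mass{span s}`
by the hypothesis (converted to `ℝ≥0∞` through `ENNReal.ofReal_tsum_of_nonneg`, the weights being summable by
Kesten's identity `Theorems.KestenIdentity_proof`), and `C' = 1 + Σ_u (2u+3) C e^{-(u+1)/C}`, a convergent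
series (`r = e^{-1/C} < 1`; `hasSum_coe_mul_geometric_of_norm_lt_one`, `summable_geometric_of_lt_one`).
No definitions.
-/

noncomputable section

open scoped BigOperators ENNReal
open Classical
open Literature.Probability.LatticeModels
open Literature.Probability.RandomPlanarGeometry Literature.Probability.RandomPlanarGeometry.SAW

namespace Summit.CriticalPhenomena.SAWScalingLimit.Theorems

namespace ExtentOfExpTail

/-! ### The discrete layer cake `e² ≤ s²(1 + Σ_{(u+1)s ≤ e} (2u+3))` -/

/-- `(m+1)² = 1 + Σ_{u<m} (2u+3)`. -/
theorem succ_sq_eq_one_add_sum (m : ℕ) :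
    (m + 1) ^ 2 = 1 + ∑ u ∈ Finset.range m, (2 * u + 3) := by
  induction m with
  | zero => simp
  | succ m ih =>
    rw [Finset.sum_range_succ, ← add_assoc, ← ih]
    ring

/-- Discrete layer cake in `ℕ`: `e² ≤ s²(1 + Σ_{u < e/s} (2u+3))` for `s ≥ 1` (because `e < (e/s + 1)s`). -/
theorem sq_le_sq_mul_sum (s e : ℕ) (hs : 1 ≤ s) :
    e ^ 2 ≤ s ^ 2 * (1 + ∑ u ∈ Finset.range (e / s), (2 * u + 3)) := by
  rw [← succ_sq_eq_one_add_sum, ← mul_pow]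
  exact Nat.pow_le_pow_left (Nat.lt_mul_div_succ e hs).le 2

/-- The layer cake in `ℝ≥0∞`, the finite sum written as a series over the levels `(u+1)s ≤ e`. -/
theorem cast_sq_le (s e : ℕ) (hs : 1 ≤ s) :
    (e : ℝ≥0∞) ^ 2 ≤
      (s : ℝ≥0∞) ^ 2 * (1 + ∑' u : ℕ, if (u + 1) * s ≤ e then ((2 * u + 3 : ℕ) : ℝ≥0∞) else 0) := by
  have hsum : (∑' u : ℕ, if (u + 1) * s ≤ e then ((2 * u + 3 : ℕ) : ℝ≥0∞) else 0) =
      ∑ u ∈ Finset.range (e / s), ((2 * u + 3 : ℕ) : ℝ≥0∞) := by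
    rw [tsum_eq_sum (s := Finset.range (e / s))]
    · refine Finset.sum_congr rfl fun u hu => if_pos ?_
      exact (Nat.mul_le_mul_right s (Nat.succ_le_of_lt (Finset.mem_range.1 hu))).trans
        (Nat.div_mul_le_self e s)
    · intro u hu
      rw [if_neg]
      intro hle
      have hu' : e / s + 1 ≤ u + 1 :=
        Nat.succ_le_succ (Nat.not_lt.1 fun h => hu (Finset.mem_range.2 h))
      have h1 : e < s * (e / s + 1) := Nat.lt_mul_div_succ e hs
      have h2 : s * (e / s + 1) ≤ (u + 1) * s := by
        rw [mul_comm]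
        exact Nat.mul_le_mul_right s hu'
      exact absurd (h1.trans_le (h2.trans hle)) (lt_irrefl e)
  rw [hsum]
  exact_mod_cast sq_le_sq_mul_sum s e hs

/-! ### The abstract layer-cake bound for a weight on a type -/

/-- **Abstract layer-cake bound.** For a weight `μ` on a type, a level function `e`, an event `A` and a scale
`s ≥ 1`: if every tail `{A, (u+1)s ≤ e}` has `μ`-mass at most `a u` times the mass of `A`, then the
`A`-restricted second moment of `e` is at most `s²(1 + Σ_u (2u+3) a_u)` times the mass of `A`. -/
theorem tsum_sq_mul_le {ι : Type*} (μ : ι → ℝ≥0∞) (e : ι → ℕ) (A : ι → Prop) [DecidablePred A]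
    (s : ℕ) (hs : 1 ≤ s) (a : ℕ → ℝ≥0∞)
    (ha : ∀ u : ℕ, (∑' i, if A i ∧ (u + 1) * s ≤ e i then μ i else 0) ≤
      a u * ∑' i, if A i then μ i else 0) :
    (∑' i, if A i then (e i : ℝ≥0∞) ^ 2 * μ i else 0) ≤
      (s : ℝ≥0∞) ^ 2 * (1 + ∑' u, ((2 * u + 3 : ℕ) : ℝ≥0∞) * a u) * ∑' i, if A i then μ i else 0 := by
  calc (∑' i, if A i then (e i : ℝ≥0∞) ^ 2 * μ i else 0)
      ≤ ∑' i, (s : ℝ≥0∞) ^ 2 * ((if A i then μ i else 0) +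
          ∑' u, ((2 * u + 3 : ℕ) : ℝ≥0∞) * (if A i ∧ (u + 1) * s ≤ e i then μ i else 0)) := by
        refine ENNReal.tsum_le_tsum fun i => ?_
        by_cases hA : A i
        · simp only [hA, if_true, true_and]
          calc (e i : ℝ≥0∞) ^ 2 * μ i
              ≤ (s : ℝ≥0∞) ^ 2 *
                  (1 + ∑' u : ℕ, if (u + 1) * s ≤ e i then ((2 * u + 3 : ℕ) : ℝ≥0∞) else 0) * μ i :=
                mul_le_mul_left (cast_sq_le s (e i) hs) _
            _ = (s : ℝ≥0∞) ^ 2 * (μ i +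
                  ∑' u, ((2 * u + 3 : ℕ) : ℝ≥0∞) * (if (u + 1) * s ≤ e i then μ i else 0)) := by
                rw [mul_assoc, add_mul, one_mul, ← ENNReal.tsum_mul_right]
                simp_rw [ite_mul, zero_mul, mul_ite, mul_zero]
        · simp [hA]
    _ = (s : ℝ≥0∞) ^ 2 * ((∑' i, if A i then μ i else 0) +
          ∑' u, ((2 * u + 3 : ℕ) : ℝ≥0∞) * ∑' i, if A i ∧ (u + 1) * s ≤ e i then μ i else 0) := by
        rw [ENNReal.tsum_mul_left, ENNReal.tsum_add, ENNReal.tsum_comm]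
        simp_rw [ENNReal.tsum_mul_left]
    _ ≤ (s : ℝ≥0∞) ^ 2 * ((∑' i, if A i then μ i else 0) +
          ∑' u, ((2 * u + 3 : ℕ) : ℝ≥0∞) * (a u * ∑' i, if A i then μ i else 0)) := by
        gcongr with u
        exact ha u
    _ = (s : ℝ≥0∞) ^ 2 * (1 + ∑' u, ((2 * u + 3 : ℕ) : ℝ≥0∞) * a u) * ∑' i, if A i then μ i else 0 := by
        rw [mul_assoc ((s : ℝ≥0∞) ^ 2), add_mul, one_mul, ← ENNReal.tsum_mul_right]
        simp_rw [mul_assoc]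

/-! ### Kesten's weights: real indicator sums as `ℝ≥0∞` sums -/

/-- Real indicator sums of Kesten's (summable) weight are the corresponding `ℝ≥0∞` sums. -/
theorem ofReal_tsum_indicator (p : {w : List Step // IsIrrBridge w} → Prop) [DecidablePred p] :
    ENNReal.ofReal (∑' w : {w : List Step // IsIrrBridge w},
        {w : {w : List Step // IsIrrBridge w} | p w}.indicator (fun w => criticalFugacity ^ w.1.length) w) =
      ∑' w : {w : List Step // IsIrrBridge w},
        if p w then ENNReal.ofReal (criticalFugacity ^ w.1.length) else 0 := by
  have hK : HasSum (fun w : {w : List Step // IsIrrBridge w} => criticalFugacity ^ w.1.length) 1 :=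
    KestenIdentity_proof
  rw [ENNReal.ofReal_tsum_of_nonneg
    (fun w => Set.indicator_nonneg (fun w _ => pow_nonneg KestenIdentity.criticalFugacity_nonneg _) w)
    (hK.summable.indicator _)]
  refine tsum_congr fun w => ?_
  simp only [Set.indicator_apply, Set.mem_setOf_eq]
  split_ifs <;> simp

end ExtentOfExpTail

open ExtentOfExpTail in
/-- **Stub UE `stub_extentSecondMoment_of_expTail`** (registered): the exponential conditional tail of the
extent of one irreducible bridge given its span (UAT-exp) implies the conditional second-moment ceiling
`Σ_{span s} ext² x_c^{|w|} ≤ C' s² · mass{span s}` (U2), with `C' = 1 + Σ_{u ≥ 0} (2u+3) C e^{-(u+1)/C}`. -/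
theorem stub_extentSecondMoment_of_expTail :
    (∃ C : ℝ, 0 < C ∧ ∀ s t : ℕ, 1 ≤ s → 1 ≤ t →
      (∑' w : {w : List Step // IsIrrBridge w},
          {w : {w : List Step // IsIrrBridge w} | xEnd w.1 = s ∧
              t * s ≤ (Finset.range (w.1.length + 1)).sup fun i => (traj w.1 i 1).natAbs}.indicator
            (fun w => criticalFugacity ^ w.1.length) w) ≤
        C * Real.exp (-(t : ℝ) / C) * ∑' w : {w : List Step // IsIrrBridge w},
          {w : {w : List Step // IsIrrBridge w} | xEnd w.1 = s}.indicator
            (fun w => criticalFugacity ^ w.1.length) w) →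
    (∃ C : ℝ, 0 < C ∧ ∀ s : ℕ, 1 ≤ s →
      (∑' w : {w : List Step // IsIrrBridge w},
          if xEnd w.1 = (s : ℤ) then
            (((Finset.range (w.1.length + 1)).sup fun i => (traj w.1 i 1).natAbs : ℕ) : ℝ≥0∞) ^ 2 *
              ENNReal.ofReal (criticalFugacity ^ w.1.length) else 0) ≤
        ENNReal.ofReal (C * (s : ℝ) ^ 2) *
          ∑' w : {w : List Step // IsIrrBridge w},
            if xEnd w.1 = (s : ℤ) then 1 * ENNReal.ofReal (criticalFugacity ^ w.1.length) else 0) := by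
  rintro ⟨C, hC, hH⟩
  -- the ratio `r = e^{-1/C} ∈ (0, 1)` and `e^{-n/C} = rⁿ`
  have hr0 : 0 < Real.exp (-1 / C) := Real.exp_pos _
  have hr1 : Real.exp (-1 / C) < 1 := Real.exp_lt_one_iff.2 (div_neg_of_neg_of_pos neg_one_lt_zero hC)
  have hexp : ∀ n : ℕ, Real.exp (-(n : ℝ) / C) = Real.exp (-1 / C) ^ n := fun n => by
    rw [← Real.exp_nat_mul]
    congr 1
    ring
  -- the series `Σ_u (2u+3) · C e^{-(u+1)/C}` converges
  have hg0 : ∀ u : ℕ, 0 ≤ ((2 * u + 3 : ℕ) : ℝ) * (C * Real.exp (-((u + 1 : ℕ) : ℝ) / C)) := fun u =>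
    mul_nonneg (Nat.cast_nonneg _) (mul_nonneg hC.le (Real.exp_pos _).le)
  have hg : Summable fun u : ℕ => ((2 * u + 3 : ℕ) : ℝ) * (C * Real.exp (-((u + 1 : ℕ) : ℝ) / C)) := by
    have hn : ‖Real.exp (-1 / C)‖ < 1 := by
      rw [Real.norm_eq_abs, abs_of_pos hr0]
      exact hr1
    have h1 : Summable fun n : ℕ => (n : ℝ) * Real.exp (-1 / C) ^ n :=
      (hasSum_coe_mul_geometric_of_norm_lt_one hn).summable
    have h2 : Summable fun n : ℕ => Real.exp (-1 / C) ^ n := summable_geometric_of_lt_one hr0.le hr1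
    refine (((h1.mul_left 2).add (h2.mul_left 3)).mul_left (C * Real.exp (-1 / C))).congr fun u => ?_
    rw [hexp]
    push_cast
    ring
  set S : ℝ := ∑' u : ℕ, ((2 * u + 3 : ℕ) : ℝ) * (C * Real.exp (-((u + 1 : ℕ) : ℝ) / C)) with hS
  have hS0 : 0 ≤ S := tsum_nonneg hg0
  refine ⟨1 + S, add_pos_of_pos_of_nonneg one_pos hS0, fun s hs => ?_⟩
  simp only [one_mul]
  -- the abstract bound, fed with the hypothesis converted to `ℝ≥0∞`
  have key := tsum_sq_mul_le
    (fun w : {w : List Step // IsIrrBridge w} => ENNReal.ofReal (criticalFugacity ^ w.1.length))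
    (fun w => (Finset.range (w.1.length + 1)).sup fun i => (traj w.1 i 1).natAbs)
    (fun w => xEnd w.1 = (s : ℤ)) s hs
    (fun u => ENNReal.ofReal (C * Real.exp (-((u + 1 : ℕ) : ℝ) / C))) (fun u => by
      have h := ENNReal.ofReal_le_ofReal (hH s (u + 1) hs (Nat.le_add_left 1 u))
      rw [ENNReal.ofReal_mul (mul_nonneg hC.le (Real.exp_pos _).le), ofReal_tsum_indicator,
        ofReal_tsum_indicator] at h
      exact h)
  refine key.trans (le_of_eq ?_)
  -- the constant: `s² (1 + Σ_u (2u+3) · ofReal (C e^{-(u+1)/C})) = ofReal ((1 + S) s²)`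
  congr 1
  rw [ENNReal.ofReal_mul (add_nonneg zero_le_one hS0), ENNReal.ofReal_pow (Nat.cast_nonneg _),
    ENNReal.ofReal_natCast, mul_comm ((s : ℝ≥0∞) ^ 2), ENNReal.ofReal_add zero_le_one hS0,
    ENNReal.ofReal_one, hS, ENNReal.ofReal_tsum_of_nonneg hg0 hg]
  congr 2
  refine tsum_congr fun u => ?_
  rw [ENNReal.ofReal_mul (Nat.cast_nonneg _), ENNReal.ofReal_natCast]

end Summit.CriticalPhenomena.SAWScalingLimit.Theorems
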